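import Summits.BirchSwinnertonDyer.BirchSwinnertonDyer.Theorems.GenusKolyvaginAtTwoPowDvdShaCardAtTwoRTKolyvaginMinima
import HarnessLib

/-!
# Route `GenusKolyvaginAtTwo`, supply cruxes 23491 (`GenusDeepSupplyAtTwoNegDiscNarrow`, Δ<0) and 25504 (Δ>0) — NEGATIVE LANE:
# the conclusion of the registered stubs C‴ / C⁺‴ (kernels K₄ / K₄⁺) is NEVER witnessed at conductor `1`; a witness level is a
# square-free `n > 1` whose primes are `ℓ ≡ 3 (mod 4)` with `4 ∣ a_ℓ`

Seat `refuter-cdisprove-stmt-BirchSwinnertonDyer-23491-g0` (kernel refuter, no kit), `--supports stmt-BirchSwinnertonDyer-23491`.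
THEOREMS ONLY (no definition, no named fact, no `sorry`); UNCONDITIONAL.  **BSD is NOT proved or disproved for any curve by this file;
nothing is refuted and no item is closed** — these are the BOUNDARY lemmas of the cdisprove census (`Cruxes/GenusDeepSupplyAtTwoNegDiscNarrow/
Disproof.lean`, `Cruxes/GenusPrimitiveSupplyAtTwoPosDiscShallow/Disproof.lean`: verdict «no witness found» on both stubs).

The supply kernels K₄ (binder `hK4` of `GenusSupplyNarrow.stubC_negDisc_of_selmerSplit`, p762183) and K₄⁺ (binder `hK4` of
`GenusSupplyPos.stubC_posDisc_of_selmerSplit`, p762235) conclude `∃ n d, Squarefree n ∧ (∀ ℓ ∣ n, deep Zhang–Kolyvagin prime at 2 ∧ …) ∧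
P_d(n) ∉ 2·E(K[n])` on a frame carrying a conductor-`1` datum `d₁` with `2^{M₀} ∣ P_{d₁}(1)` and `1 ≤ M₀`.
* §1 `exists_two_smul_derivedPoint_of_conductor_one` — on such a frame EVERY conductor-`1` datum `d` has `P_d(1) ∈ 2E(K[1])`
  (level-one rigidity `GenusExact.RelaxedCount.derivedPoint_eq_of_conductor_one`: all conductor-`1` data share `P(1)`); hence
  `level_ne_one_of_not_exists_two_smul` (a witness has `n ≠ 1`) and `one_lt_level_of_not_exists_two_smul` /
  `primeFactors_nonempty_of_not_exists_two_smul` (square-free ⟹ `1 < n`, a prime factor exists).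
* §2 `deepKolyvaginPrime_shape` — a Zhang–Kolyvagin prime at `2` of index `≥ 2` is a prime `ℓ ≠ 2`,
  `ℓ ∤ N`, `ℓ ∤ d_K`, `4 ∣ ℓ + 1`, `4 ∣ a_ℓ` (`le_kolyvaginIndex_iff`); `deepKolyvaginPrime_mod_four`: `ℓ ≡ 3 (mod 4)`, `3 ≤ ℓ`.  So
  `#Ẽ(𝔽_ℓ) = ℓ + 1 − a_ℓ ≡ 0 (mod 4)` and `Frob_ℓ|E[4]` has characteristic polynomial `≡ X² − 1 (mod 4)` — the arithmetic behind Gross's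
  Prop. 6.2 at a deep prime (census §3 of the Disproof files: on the `M₀ ≥ 1` cells every `d(ℓ)_λ = 0`, the classes `c₁(ℓ)` are Selmer).
References: [GrossLMS1991] B. H. Gross, Kolyvagin's work on modular elliptic curves, LMS LN 153 (1991), §3 (3.3), §4, Prop. 6.2, §11;
[WZhang2014] W. Zhang, Camb. J. Math. 2 (2014), Notations (xii).
-/

set_option autoImplicit false
set_option linter.dupNamespace false -- `Summit.<P>.<Sub>` repeats `BirchSwinnertonDyer` (D-0017)

noncomputable section

open scoped Classical

namespace Summit.BirchSwinnertonDyer.BirchSwinnertonDyer.Theorems.GenusSupplyNarrow.Negative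

open WeierstrassCurve Literature.NumberTheory.EllipticCurves Literature.NumberTheory.EllipticCurves.ModularForms

variable {K : Type} [Field K] [NumberField K]

/-! ## §1 Level-one exclusion -/

/-- **Every conductor-`1` datum has `2`-divisible `P(1)` on a frame with `2^{M₀} ∣ P_{d₁}(1)`, `1 ≤ M₀`.**  All conductor-`1` data over one
frame `(Dt, β, ι)` share `P(1)` (`GenusExact.RelaxedCount.derivedPoint_eq_of_conductor_one`), and `2^{M₀}·Q = 2·(2^{M₀-1}·Q)`: the conclusion
of the supply kernels K₄ / K₄⁺ is never witnessed at `n = 1`. [cite: GrossLMS1991, §4 (P_1 = y_K)] -/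
theorem exists_two_smul_derivedPoint_of_conductor_one (W : WeierstrassCurve ℚ) [W.IsElliptic] {N : ℕ} [NeZero N]
    {Dt : ModularParametrizationData W N} {β : ℤ} {ι : K →+* ℂ} (d₁ d : KolyvaginHeegnerData Dt β ι 1) {M₀ : ℕ} (hM : 1 ≤ M₀)
    (hdiv : ∃ Q : (W.baseChange (ringClassField K ι 1)).toAffine.Point, ((2 ^ M₀ : ℕ) : ℤ) • Q = d₁.derivedPoint) :
    ∃ Q : (W.baseChange (ringClassField K ι 1)).toAffine.Point, (2 : ℤ) • Q = d.derivedPoint := by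
  obtain ⟨Q, hQ⟩ := hdiv
  refine ⟨((2 ^ (M₀ - 1) : ℕ) : ℤ) • Q, ?_⟩
  rw [GenusExact.RelaxedCount.derivedPoint_eq_of_conductor_one W d₁ d, smul_smul, ← hQ]
  congr 1
  have h2 : 2 * 2 ^ (M₀ - 1) = 2 ^ M₀ := by
    rw [← pow_succ']
    congr 1
    omega
  exact_mod_cast h2

/-- **A `2`-primitive derived point lives at level `n ≠ 1`** (on a frame with `2^{M₀} ∣ P(1)`, `1 ≤ M₀`). [cite: GrossLMS1991, §4] -/
theorem level_ne_one_of_not_exists_two_smul (W : WeierstrassCurve ℚ) [W.IsElliptic] {N : ℕ} [NeZero N]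
    {Dt : ModularParametrizationData W N} {β : ℤ} {ι : K →+* ℂ} (d₁ : KolyvaginHeegnerData Dt β ι 1) {M₀ : ℕ} (hM : 1 ≤ M₀)
    (hdiv : ∃ Q : (W.baseChange (ringClassField K ι 1)).toAffine.Point, ((2 ^ M₀ : ℕ) : ℤ) • Q = d₁.derivedPoint)
    {n : ℕ} (d : KolyvaginHeegnerData Dt β ι n)
    (hprim : ¬ ∃ Q : (W.baseChange (ringClassField K ι n)).toAffine.Point, (2 : ℤ) • Q = d.derivedPoint) : n ≠ 1 := by
  rintro rfl
  exact hprim (exists_two_smul_derivedPoint_of_conductor_one W d₁ d hM hdiv)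

/-- **… and (square-free) at level `n > 1`.** [cite: GrossLMS1991, §4] -/
theorem one_lt_level_of_not_exists_two_smul (W : WeierstrassCurve ℚ) [W.IsElliptic] {N : ℕ} [NeZero N]
    {Dt : ModularParametrizationData W N} {β : ℤ} {ι : K →+* ℂ} (d₁ : KolyvaginHeegnerData Dt β ι 1) {M₀ : ℕ} (hM : 1 ≤ M₀)
    (hdiv : ∃ Q : (W.baseChange (ringClassField K ι 1)).toAffine.Point, ((2 ^ M₀ : ℕ) : ℤ) • Q = d₁.derivedPoint)
    {n : ℕ} (hn : Squarefree n) (d : KolyvaginHeegnerData Dt β ι n)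
    (hprim : ¬ ∃ Q : (W.baseChange (ringClassField K ι n)).toAffine.Point, (2 : ℤ) • Q = d.derivedPoint) : 1 < n := by
  have h1 : n ≠ 1 := level_ne_one_of_not_exists_two_smul W d₁ hM hdiv d hprim
  have h0 : n ≠ 0 := by
    rintro rfl
    exact not_squarefree_zero hn
  omega

/-- **… so it has a prime factor** (by the deep clause of K₄ / K₄⁺ a Zhang–Kolyvagin prime of index `≥ 2`, §2). [cite: GrossLMS1991, §4] -/
theorem primeFactors_nonempty_of_not_exists_two_smul (W : WeierstrassCurve ℚ) [W.IsElliptic] {N : ℕ} [NeZero N]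
    {Dt : ModularParametrizationData W N} {β : ℤ} {ι : K →+* ℂ} (d₁ : KolyvaginHeegnerData Dt β ι 1) {M₀ : ℕ} (hM : 1 ≤ M₀)
    (hdiv : ∃ Q : (W.baseChange (ringClassField K ι 1)).toAffine.Point, ((2 ^ M₀ : ℕ) : ℤ) • Q = d₁.derivedPoint)
    {n : ℕ} (hn : Squarefree n) (d : KolyvaginHeegnerData Dt β ι n)
    (hprim : ¬ ∃ Q : (W.baseChange (ringClassField K ι n)).toAffine.Point, (2 : ℤ) • Q = d.derivedPoint) :
    n.primeFactors.Nonempty := by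
  have h := one_lt_level_of_not_exists_two_smul W d₁ hM hdiv hn d hprim
  rw [Finset.nonempty_iff_ne_empty, Ne, Nat.primeFactors_eq_empty]
  omega

/-! ## §2 The shape of a deep Zhang–Kolyvagin prime at `2` -/

/-- **A Zhang–Kolyvagin prime at `2` of index `≥ 2`** (`IsKolyvaginPrime N W K 2 ℓ`, `2 ≤ kolyvaginIndex W 2 ℓ`) is a prime `ℓ ≠ 2`,
`ℓ ∤ N`, `ℓ ∤ d_K`, with `4 ∣ ℓ + 1` and `4 ∣ a_ℓ` — so `#Ẽ(𝔽_ℓ) = ℓ + 1 − a_ℓ ≡ 0 (mod 4)` and `Frob_ℓ|E[4]` has characteristic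
polynomial `≡ X² − 1 (mod 4)`. [cite: WZhang2014, Notations (xii)] [cite: GrossLMS1991, §3 (3.3)] -/
theorem deepKolyvaginPrime_shape {N : ℕ} {W : WeierstrassCurve ℚ} [W.IsGloballyMinimal] {K : Type} [Field K]
    [NumberField K] {ℓ : ℕ} (hK : Zhang2014.IsKolyvaginPrime N W K 2 ℓ) (hidx : 2 ≤ Zhang2014.kolyvaginIndex W 2 ℓ) :
    ℓ.Prime ∧ ¬ ℓ ∣ N ∧ ¬ ((ℓ : ℤ) ∣ NumberField.discr K) ∧ ℓ ≠ 2 ∧ 4 ∣ ℓ + 1 ∧ (4 : ℤ) ∣ W.frobeniusTrace ℓ := by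
  haveI : Fact (Nat.Prime 2) := ⟨Nat.prime_two⟩
  obtain ⟨h1, h2⟩ := (Zhang2014.le_kolyvaginIndex_iff (W := W) (p := 2) (M := 2) (ℓ := ℓ)).mp hidx
  refine ⟨hK.1, hK.2.1, hK.2.2.1, hK.2.2.2.1, ?_, ?_⟩
  · norm_num at h1
    exact h1
  · norm_num at h2
    exact h2

/-- **… in particular `ℓ ≡ 3 (mod 4)` and `3 ≤ ℓ`**: the first possible witness level of the supply kernels is such a prime.
[cite: WZhang2014, Notations (xii)] -/
theorem deepKolyvaginPrime_mod_four {N : ℕ} {W : WeierstrassCurve ℚ} [W.IsGloballyMinimal] {K : Type} [Field K]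
    [NumberField K] {ℓ : ℕ} (hK : Zhang2014.IsKolyvaginPrime N W K 2 ℓ) (hidx : 2 ≤ Zhang2014.kolyvaginIndex W 2 ℓ) :
    ℓ % 4 = 3 ∧ 3 ≤ ℓ := by
  obtain ⟨hp, -, -, -, h4, -⟩ := deepKolyvaginPrime_shape hK hidx
  have h2 := hp.two_le
  omega


end Summit.BirchSwinnertonDyer.BirchSwinnertonDyer.Theorems.GenusSupplyNarrow.Negative


end
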